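import Summits.CriticalPhenomena.CardyFormulaZ2.Theorems.CardyBoundaryCoulombGasBoundaryDefectGaussianRStubRealisabilityPart2
import Literature.Probability.Percolation.FKLoopWindingCells

/-!
# Stub `stub_realisability` of line `rainbow-monomials-in-excursion-kernels` — Part 3:
# loop orientations are gradients on hole-free domains; the closed-collar dictionary `Z = 2^{|E|}`
# (crux `BoundaryDefectGaussianR`, stmt-CriticalPhenomena-14132)

Last third of the closed-collar dictionary **D1** for
`Literature.Probability.LatticeModels.CollarLegModel`, continuing Parts 1–2.

* `exists_cellHeight` — for a bond configuration `ξ` of a piece `Λ` and an orientation `s` of its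
  loops (an arrow configuration invariant under the turning rule `pieceCornerPerm Λ ξ`), the
  function `H(F) = ∑_{loops S} ε_S · wnd(S, F)` on the cells `F` of the medial lattice (signed sum
  of the combinatorial winding numbers `MedialTrail.wnd` of the orbit trails) jumps by `ε(s c)`
  across every corner `c` over `Λ` (`FKLoopWindingCells.wnd_vcell_sub_wnd_fcell`), does not jump
  across corners off `Λ`, and vanishes far to the west;
* `cellHeight_vcell_eq_zero` — on a HOLE-FREE `V` (`ℤ² ∖ V` king-connected) `H` vanishes at
  every vertex off `V`, hence at every collar face: the heights `H` form a height configuration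
  of the closed collar whose arrows are `s` (`exists_config_of_arrows`);
* with Part 1 (`∑_s W_Λ(s) = 2^{|E|}`) and Part 2 (weight matching, injectivity):
  **`Z(ofDomain V) = 2^{|inducedEdges V|}`** for hole-free `V` (`Z_ofDomain_eq_two_pow`) — the
  loop weight of the BKW coupling at `q = 1` is `e^{iπ/3} + e^{-iπ/3} = 1` and no loop encloses a
  collar face.

Registered sub-goal carried here: `s9_closedCollarDictionary` (= D1).
-/

noncomputable section

namespace Summit.CriticalPhenomena.CardyFormulaZ2.Cruxes.BoundaryDefectGaussianR.RainbowMonomialsInExcursionKernels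

open Finset Literature.Probability.LatticeModels Literature.Probability.Percolation
open Literature.Probability.Percolation.BKW Literature.Probability.LatticeModels.CollarLegModel
open Literature.Probability.LatticeModels.MedialTrail Literature.GroupTheory.CombinatorialGroupTheory
open Function

/-! ### Heights from loop orientations on a piece `Λ` -/

section Loops

variable {Λ : Finset (Site 2)} (ξ : Finset (Sym2 ↥Λ))

/-- Iterates of the turning rule keep corners over `Λ`. [folklore] -/
theorem iterate_mem_cornerSet {c : Site 2 × Fin 4} (hc : c ∈ cornerSet Λ) (m : ℕ) :
    (nextCorner (liftCfg Λ ξ))^[m] c ∈ cornerSet Λ := by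
  induction m with
  | zero => exact hc
  | succ m ih => rw [iterate_succ_apply']; exact (nextCorner_mem_cornerSet_iff ξ _).2 ih

/-- Orbit membership under the turning rule is cycle membership for the piece permutation. [folklore] -/
theorem exists_iterate_eq_iff_mem_cls (c₀ c : ↥(cornerSet Λ)) :
    (∃ m, (nextCorner (liftCfg Λ ξ))^[m] (c₀ : Site 2 × Fin 4) = c) ↔ c ∈ PairingGenus.cls (pieceCornerPerm Λ ξ) c₀ := by
  rw [PairingGenus.mem_cls]
  constructor
  · rintro ⟨m, hm⟩
    refine ⟨(m : ℤ), ?_⟩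
    rw [zpow_natCast]
    exact Subtype.ext (by rw [pieceCornerPerm_pow_apply_val, hm])
  · intro h
    obtain ⟨m, hm⟩ := h.exists_nat_pow_eq
    exact ⟨m, by rw [← pieceCornerPerm_pow_apply_val, hm]⟩

/-- Trail points of loops over `Λ` lie weakly east of `min_{x ∈ Λ} (x₀ + x₁) - 1` in medial coordinates. [folklore] -/
theorem le_fst_of_mem_orbitTrail {m : ℤ} (hm : ∀ x ∈ Λ, m ≤ x 0 + x 1) {c₀ : Site 2 × Fin 4} (hc₀ : c₀ ∈ cornerSet Λ)
    {P : MedialTrail.Pt} (hP : P ∈ orbitTrail (liftCfg Λ ξ) c₀) : m - 1 ≤ P.1 := by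
  rw [orbitTrail, List.mem_map] at hP
  obtain ⟨i, -, rfl⟩ := hP
  have h1 := hm _ (mem_cornerSet.1 (iterate_mem_cornerSet ξ hc₀ i))
  have h2 := neg_one_le_cposOff_fst ((nextCorner (liftCfg Λ ξ))^[i] c₀).2
  simp only [cpos]
  omega

/-- **Heights from loop orientations.** For an orientation `s` of the loops of `ξ` there is a
function `H` on the cells of the medial lattice — `H(F) = ∑_S ε_S wnd(S, F)`, the signed sum of
the combinatorial winding numbers of the loops — which jumps by the arrow sign across every corner
over `Λ`, does not jump across corners off `Λ`, and vanishes far to the west. [cite: BaxterKellandWu1976, §3] -/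
theorem exists_cellHeight {s : ↥(cornerSet Λ) → Bool} (hs : ∀ c, s (pieceCornerPerm Λ ξ c) = s c) :
    ∃ H : MedialTrail.Pt → ℤ,
      (∀ c : ↥(cornerSet Λ), H (vcell (c : Site 2 × Fin 4).1) - H (fcell (cFace (c : Site 2 × Fin 4))) = sgn (s c)) ∧
      (∀ x ∉ Λ, ∀ k : Fin 4, H (vcell x) = H (fcell (cFace (x, k)))) ∧
      ∃ X : ℤ, ∀ x : Site 2, x 0 + x 1 < X → H (vcell x) = 0 := by
  classical
  set σ := pieceCornerPerm Λ ξ with hσ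
  -- a representative corner of each cycle
  have hrep : ∀ S : ↥(cycles σ), ∃ c : ↥(cornerSet Λ), PairingGenus.cls σ c = S.1 := fun S => by
    obtain ⟨c, -, hc⟩ := mem_image.1 S.2; exact ⟨c, hc⟩
  choose rep hrep using hrep
  have hjump := fun (S : ↥(cycles σ)) (c : Site 2 × Fin 4) =>
    wnd_vcell_sub_wnd_fcell (mem_periodicPts_of_mem_cornerSet ξ (rep S).2) c
  refine ⟨fun F => ∑ S : ↥(cycles σ), sgn (s (rep S)) * wnd (orbitTrail (liftCfg Λ ξ) (rep S : Site 2 × Fin 4)) F,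
    fun c => ?_, fun x hx k => ?_, ?_⟩
  · -- the jump across a corner over `Λ`
    rw [← Finset.sum_sub_distrib]
    have hterm : ∀ S : ↥(cycles σ),
        sgn (s (rep S)) * wnd (orbitTrail (liftCfg Λ ξ) (rep S : Site 2 × Fin 4)) (vcell (c : Site 2 × Fin 4).1) -
          sgn (s (rep S)) * wnd (orbitTrail (liftCfg Λ ξ) (rep S : Site 2 × Fin 4)) (fcell (cFace (c : Site 2 × Fin 4))) =
        if c ∈ S.1 then sgn (s (rep S)) else 0 := by
      intro S
      rw [← mul_sub, hjump S c]
      by_cases h : c ∈ S.1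
      · rw [if_pos ((exists_iterate_eq_iff_mem_cls ξ (rep S) c).2 (by rw [hrep]; exact h)), if_pos h, mul_one]
      · rw [if_neg (fun h' => h (by rw [← hrep]; exact (exists_iterate_eq_iff_mem_cls ξ (rep S) c).1 h')),
          if_neg h, mul_zero]
    rw [Finset.sum_congr rfl fun S _ => hterm S]
    rw [Finset.sum_eq_single (⟨PairingGenus.cls σ c, cls_mem_cycles _ c⟩ : ↥(cycles σ))]
    · rw [if_pos (PairingGenus.mem_cls_self _ c)]
      congr 1
      apply apply_eq_of_sameCycle hs
      rw [← PairingGenus.cls_eq_cls_iff, hrep]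
    · intro S _ hne
      rw [if_neg]
      intro hc
      apply hne
      apply Subtype.ext
      dsimp only
      rw [← hrep S] at hc ⊢
      exact PairingGenus.cls_eq_cls_iff.2 (PairingGenus.mem_cls.1 hc)
    · intro h; exact absurd (Finset.mem_univ _) h
  · -- no jump across a corner off `Λ`
    refine Finset.sum_congr rfl fun S _ => ?_
    have h := hjump S (x, k)
    rw [if_neg] at h
    · rw [sub_eq_zero] at h; rw [h]
    · rintro ⟨m, hm⟩
      have := iterate_mem_cornerSet ξ (rep S).2 m
      rw [hm, mem_cornerSet] at this
      exact hx this
  · -- vanishing far to the west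
    obtain ⟨m, hm⟩ := Finset.bddBelow (Λ.image fun x : Site 2 => x 0 + x 1)
    have hm' : ∀ x ∈ Λ, m ≤ x 0 + x 1 := fun x hx => hm (mem_coe.2 (mem_image_of_mem _ hx))
    refine ⟨m - 1, fun x hx => Finset.sum_eq_zero fun S _ => ?_⟩
    rw [vcell, wnd_eq_zero_of_lt, mul_zero]
    intro P hP
    have := le_fst_of_mem_orbitTrail ξ hm' (rep S).2 hP
    omega

end Loops

/-! ### Hole-free domains: the heights vanish off `V` -/

/-- Two king-adjacent vertices of `ℤ²` are corners of a common face. [folklore] -/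
theorem exists_common_face {u w : ℤ × ℤ} (h : max |u.1 - w.1| |u.2 - w.2| ≤ 1) :
    ∃ k k' : Fin 4, (![u, (u.1 - 1, u.2), (u.1 - 1, u.2 - 1), (u.1, u.2 - 1)] k : ℤ × ℤ) =
      ![w, (w.1 - 1, w.2), (w.1 - 1, w.2 - 1), (w.1, w.2 - 1)] k' := by
  rw [max_le_iff, abs_le, abs_le] at h
  obtain ⟨⟨h1, h2⟩, h3, h4⟩ := h
  have hx : w.1 = u.1 - 1 ∨ w.1 = u.1 ∨ w.1 = u.1 + 1 := by omega
  have hy : w.2 = u.2 - 1 ∨ w.2 = u.2 ∨ w.2 = u.2 + 1 := by omega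
  rcases hx with hx | hx | hx <;> rcases hy with hy | hy | hy
  · exact ⟨2, 0, by simp [Prod.ext_iff, hx, hy]⟩
  · exact ⟨1, 0, by simp [Prod.ext_iff, hx, hy]⟩
  · exact ⟨1, 3, by simp [hx, hy]⟩
  · exact ⟨3, 0, by simp [Prod.ext_iff, hx, hy]⟩
  · exact ⟨0, 0, by simp [Prod.ext_iff, hx, hy]⟩
  · exact ⟨0, 3, by simp [hx, hy]⟩
  · exact ⟨3, 1, by simp [hx, hy]⟩
  · exact ⟨0, 1, by simp [hx, hy]⟩
  · exact ⟨0, 2, by simp [hx, hy]⟩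

section HoleFree

variable {V : Finset (ℤ × ℤ)} {Λ : Finset (Site 2)} (hΛ : ∀ x : Site 2, x ∈ Λ ↔ (x 0, x 1) ∈ V)
  (hV : ∀ u ∉ V, ∀ w ∉ V,
    Relation.ReflTransGen (fun b c : ℤ × ℤ => b ∉ V ∧ c ∉ V ∧ max |b.1 - c.1| |b.2 - c.2| ≤ 1) u w)
  {H : MedialTrail.Pt → ℤ} (hout : ∀ x ∉ Λ, ∀ k : Fin 4, H (vcell x) = H (fcell (cFace (x, k))))
  {X : ℤ} (hX : ∀ x : Site 2, x 0 + x 1 < X → H (vcell x) = 0)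
include hΛ hV hout hX

/-- **On a hole-free domain the heights vanish at every outside vertex**: `H ∘ vcell` is constant
along king paths off `V` (two king-adjacent outside vertices see a common face, across corners
off `Λ` there is no jump) and vanishes far to the west. [folklore] -/
theorem cellHeight_vcell_eq_zero {w : ℤ × ℤ} (hw : w ∉ V) : H (vcell ![w.1, w.2]) = 0 := by
  -- one king step
  have hstep : ∀ u u' : ℤ × ℤ, u ∉ V → u' ∉ V → max |u.1 - u'.1| |u.2 - u'.2| ≤ 1 →
      H (vcell ![u.1, u.2]) = H (vcell ![u'.1, u'.2]) := by
    intro u u' hu hu' hk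
    obtain ⟨k, k', hkk⟩ := exists_common_face hk
    rw [hout _ (fun h => hu ((vec_mem_iff hΛ u).1 h)) k, hout _ (fun h => hu' ((vec_mem_iff hΛ u').1 h)) k',
      cFace_vec, cFace_vec, hkk]
  -- a far outside vertex
  obtain ⟨m, hm⟩ := Finset.bddBelow (V.image Prod.fst)
  set w' : ℤ × ℤ := (min m X - 1, 0) with hw'
  have hw'V : w' ∉ V := fun h => by
    have := hm (mem_coe.2 (mem_image_of_mem Prod.fst h))
    simp only [hw'] at this
    omega
  have h0 : H (vcell ![w'.1, w'.2]) = 0 := by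
    apply hX
    simp only [hw', Matrix.cons_val_zero, Matrix.cons_val_one, Matrix.cons_val_fin_one]
    omega
  rw [← h0]
  have key : ∀ a b : ℤ × ℤ, Relation.ReflTransGen (fun b c : ℤ × ℤ => b ∉ V ∧ c ∉ V ∧ max |b.1 - c.1| |b.2 - c.2| ≤ 1) a b →
      H (vcell ![a.1, a.2]) = H (vcell ![b.1, b.2]) := by
    intro a b hab
    induction hab with
    | refl => rfl
    | tail _ hbc ih => exact ih.trans (hstep _ _ hbc.1 hbc.2.1 hbc.2.2)
  exact key w w' (hV w hw w' hw'V)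

/-- **Collar faces have height zero** on a hole-free domain. [folklore] -/
theorem cellHeight_fcell_eq_zero {f : ℤ × ℤ} (hf : ¬ SixVertex.faceCorners f ⊆ V) : H (fcell ![f.1, f.2]) = 0 := by
  obtain ⟨w, hw, hwV⟩ := not_subset.1 hf
  obtain ⟨k, hk⟩ : ∃ k : Fin 4, (![w, (w.1 - 1, w.2), (w.1 - 1, w.2 - 1), (w.1, w.2 - 1)] k : ℤ × ℤ) = f := by
    simp only [SixVertex.faceCorners, mem_insert, mem_singleton] at hw
    rcases hw with rfl | rfl | rfl | rfl
    · exact ⟨0, rfl⟩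
    · exact ⟨1, by simp⟩
    · exact ⟨3, by simp⟩
    · exact ⟨2, by simp⟩
  have h1 := hout _ (fun h => hwV ((vec_mem_iff hΛ w).1 h)) k
  rw [cFace_vec, hk, cellHeight_vcell_eq_zero hΛ hV hout hX hwV] at h1
  exact h1.symm

/-- **Every orientation of the loops is a gradient on a hole-free domain**: given the heights `H`
of `exists_cellHeight`, the assignment (vertex `x ↦ H(vcell x)`, interior face `f ↦ H(fcell f)`)
is a height configuration of the closed collar `ofDomain V` whose arrow configuration is `s`. [cite: BaxterKellandWu1976, §3] -/
theorem exists_config_of_cellHeight {s : ↥(cornerSet Λ) → Bool}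
    (hjump : ∀ c : ↥(cornerSet Λ), H (vcell (c : Site 2 × Fin 4).1) - H (fcell (cFace (c : Site 2 × Fin 4))) = sgn (s c)) :
    ∃ h ∈ (ofDomain V).configs, ∀ c : ↥(cornerSet Λ), s c =
      decide ((ofDomain V).hv h ((c : Site 2 × Fin 4).1 0, (c : Site 2 × Fin 4).1 1) -
        (ofDomain V).hf h (cFace (c : Site 2 × Fin 4) 0, cFace (c : Site 2 × Fin 4) 1) = 1) := by
  set h : ↥(ofDomain V).freeCells → ℤ := fun c =>
    if (c : (ℤ × ℤ) × Bool).2 then H (fcell ![(c : (ℤ × ℤ) × Bool).1.1, (c : (ℤ × ℤ) × Bool).1.2])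
    else H (vcell ![(c : (ℤ × ℤ) × Bool).1.1, (c : (ℤ × ℤ) × Bool).1.2]) with hh
  have hhv : ∀ x ∈ V, (ofDomain V).hv h x = H (vcell ![x.1, x.2]) := fun x hx => by
    rw [hv_of_mem _ _ (mem_freeCells_false_ofDomain.2 hx)]; simp [hh]
  have hhf : ∀ f, (ofDomain V).hf h f = H (fcell ![f.1, f.2]) := fun f => by
    by_cases hf : f ∈ interiorFaces V
    · rw [hf_of_mem _ _ (mem_freeCells_true_ofDomain.2 hf)]; simp [hh]
    · rw [hf_ofDomain_of_not_mem _ hf, cellHeight_fcell_eq_zero hΛ hV hout hX]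
      intro hsub
      by_cases hfaces : f ∈ SixVertex.faces V
      · exact hf (mem_filter.2 ⟨hfaces, hsub⟩)
      · exact hfaces (mem_biUnion.2 ⟨f, hsub (by simp [SixVertex.faceCorners]), by simp [SixVertex.vertexFaces]⟩)
  -- the jump relation of `h` in `Site 2` form
  have hrel : ∀ c : ↥(cornerSet Λ), (ofDomain V).hv h ((c : Site 2 × Fin 4).1 0, (c : Site 2 × Fin 4).1 1) -
      (ofDomain V).hf h (cFace (c : Site 2 × Fin 4) 0, cFace (c : Site 2 × Fin 4) 1) = sgn (s c) := by
    intro c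
    have hx : ((c : Site 2 × Fin 4).1 0, (c : Site 2 × Fin 4).1 1) ∈ V := (hΛ _).1 (mem_cornerSet.1 c.2)
    rw [hhv _ hx, hhf, ← hjump c]
    have e1 : (![(c : Site 2 × Fin 4).1 0, (c : Site 2 × Fin 4).1 1] : Site 2) = (c : Site 2 × Fin 4).1 := by
      funext i; fin_cases i <;> rfl
    have e2 : (![cFace (c : Site 2 × Fin 4) 0, cFace (c : Site 2 × Fin 4) 1] : Site 2) = cFace (c : Site 2 × Fin 4) := by
      funext i; fin_cases i <;> rfl
    rw [e1, e2]
  refine ⟨h, mem_configs_of_isValid _ ?_, fun c => ?_⟩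
  · intro x hx f hf _ _
    rw [vertexCells_ofDomain] at hx
    obtain ⟨k, rfl⟩ := mem_vertexFaces_iff.1 hf
    have := hrel ⟨((![x.1, x.2] : Site 2), k), mem_cornerSet.2 ((vec_mem_iff hΛ x).2 hx)⟩
    simp only [cFace_vec, Matrix.cons_val_zero, Matrix.cons_val_one, Matrix.cons_val_fin_one, Prod.mk.eta] at this
    rw [this]
    cases s _ <;> rfl
  · rw [hrel c]
    cases s c <;> rfl

end HoleFree

/-! ### The closed-collar dictionary -/

/-- **Surjectivity of arrows on hole-free domains**: every arrow configuration over the piece of a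
hole-free `V` with nonzero BKW weight is the arrow configuration of a height configuration of the
closed collar. [cite: BaxterKellandWu1976, §3] -/
theorem exists_config_of_bkwWeight_ne_zero {V : Finset (ℤ × ℤ)} {Λ : Finset (Site 2)}
    (hΛ : ∀ x : Site 2, x ∈ Λ ↔ (x 0, x 1) ∈ V)
    (hV : ∀ u ∉ V, ∀ w ∉ V,
      Relation.ReflTransGen (fun b c : ℤ × ℤ => b ∉ V ∧ c ∉ V ∧ max |b.1 - c.1| |b.2 - c.2| ≤ 1) u w)
    {s : ↥(cornerSet Λ) → Bool}
    (hs : bkwWeight (finsetGraph (zdGraph 2) Λ).edgeFinset.powerset (pieceCornerPerm Λ) (pieceTurn Λ) 1 s ≠ 0) :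
    ∃ h ∈ (ofDomain V).configs, ∀ c : ↥(cornerSet Λ), s c =
      decide ((ofDomain V).hv h ((c : Site 2 × Fin 4).1 0, (c : Site 2 × Fin 4).1 1) -
        (ofDomain V).hf h (cFace (c : Site 2 × Fin 4) 0, cFace (c : Site 2 × Fin 4) 1) = 1) := by
  classical
  obtain ⟨ξ, hξ, -⟩ := Finset.exists_ne_zero_of_sum_ne_zero hs
  obtain ⟨H, hjump, hout, X, hX⟩ := exists_cellHeight ξ (mem_filter.1 hξ).2
  exact exists_config_of_cellHeight hΛ hV hout hX hjump

/-- **The closed-collar dictionary D1**: on a hole-free collar domain `V` (complement king-connected)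
the partition function of the closed-collar `Δ = -1/2` height model is `Z = 2^{|E|}`, the number of
bond configurations — Baxter–Kelland–Wu at `q = 1`: every loop carries `e^{iπ/3} + e^{-iπ/3} = 1`
and, no collar face being enclosed by a loop, every loop orientation is a height configuration. [cite: BaxterKellandWu1976, §3–§4] -/
theorem Z_ofDomain_eq_two_pow {V : Finset (ℤ × ℤ)}
    (hV : ∀ u ∉ V, ∀ w ∉ V,
      Relation.ReflTransGen (fun b c : ℤ × ℤ => b ∉ V ∧ c ∉ V ∧ max |b.1 - c.1| |b.2 - c.2| ≤ 1) u w) :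
    (ofDomain V).Z = (2 : ℂ) ^ (inducedEdges V).card := by
  classical
  set Λ := V.image (fun v : ℤ × ℤ => (![v.1, v.2] : Site 2)) with hΛdef
  have hΛ : ∀ x : Site 2, x ∈ Λ ↔ (x 0, x 1) ∈ V := fun x => by
    rw [hΛdef, mem_image]
    constructor
    · rintro ⟨v, hv, rfl⟩; simpa using hv
    · intro h; exact ⟨_, h, by funext j; fin_cases j <;> rfl⟩
  set A : (↥(ofDomain V).freeCells → ℤ) → ↥(cornerSet Λ) → Bool := fun h c =>
    decide ((ofDomain V).hv h ((c : Site 2 × Fin 4).1 0, (c : Site 2 × Fin 4).1 1) -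
      (ofDomain V).hf h (cFace (c : Site 2 × Fin 4) 0, cFace (c : Site 2 × Fin 4) 1) = 1) with hA
  set W : (↥(cornerSet Λ) → Bool) → ℂ :=
    bkwWeight (finsetGraph (zdGraph 2) Λ).edgeFinset.powerset (pieceCornerPerm Λ) (pieceTurn Λ) 1 with hW
  have step1 : (ofDomain V).Z = ∑ h ∈ (ofDomain V).configs, W (A h) :=
    Finset.sum_congr rfl fun h hh => weight_eq_bkwWeight hΛ (fun _ => rfl) ((mem_configs_iff_isValid _ _).1 hh)
  have hinj : Set.InjOn A ↑(ofDomain V).configs := fun h₁ hh₁ h₂ hh₂ heq =>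
    heights_eq_of_arrows_eq hΛ (s := A h₁) (fun _ => rfl) (fun c => by rw [heq]) hh₁ hh₂
  have step2 : ∑ h ∈ (ofDomain V).configs, W (A h) = ∑ s ∈ (ofDomain V).configs.image A, W s :=
    (Finset.sum_image hinj).symm
  have step3 : ∑ s ∈ (ofDomain V).configs.image A, W s = ∑ s, W s := by
    refine Finset.sum_subset (subset_univ _) fun s _ hs => ?_
    by_contra hne
    obtain ⟨h, hh, hsh⟩ := exists_config_of_bkwWeight_ne_zero hΛ hV hne
    exact hs (mem_image.2 ⟨h, hh, (funext hsh).symm⟩)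
  rw [step1, step2, step3, hW, sum_bkwWeight_one hΛ]

/-! ### Registered sub-goal of this Part -/

/-- **Sub-goal `s9_closedCollarDictionary`** (registered on stmt-CriticalPhenomena-14132) — the
dictionary fact **D1** of the line: for a finite `V ⊂ ℤ²` whose complement is king-connected
(hole-free), the closed-collar partition function of `CollarLegModel` is `Z(ofDomain V) = 2^{|E|}`,
`E = inducedEdges V` (so in particular `Z ≠ 0`, the denominator of the rainbow ratio). [cite: BaxterKellandWu1976, §3–§4] -/
theorem s9_closedCollarDictionary : ∀ V : Finset (ℤ × ℤ), (∀ u ∉ V, ∀ w ∉ V, Relation.ReflTransGen (fun b c : ℤ × ℤ => b ∉ V ∧ c ∉ V ∧ max |b.1 - c.1| |b.2 - c.2| ≤ 1) u w) → (Literature.Probability.LatticeModels.CollarLegModel.ofDomain V).Z = (2 : ℂ) ^ (Literature.Probability.LatticeModels.CollarLegModel.inducedEdges V).card :=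
  fun _ hV => Z_ofDomain_eq_two_pow hV

end Summit.CriticalPhenomena.CardyFormulaZ2.Cruxes.BoundaryDefectGaussianR.RainbowMonomialsInExcursionKernels

end
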